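import Literature.NumberTheory.EllipticCurves.RootNumberTwistProofs
import Summits.BirchSwinnertonDyer.BirchSwinnertonDyer.Theorems.AlignedTransportAtTwoMainConjectureTransportAlignedAtTwoAddTwistCoefficients
import HarnessLib

/-!
# Route `AdditiveKolyvaginRoad`, crux KS′ `LevelKolyvaginSystemsAdditive` (stmt-BirchSwinnertonDyer-21396), card `ramified-toric-habitat`
# (`Cruxes/LevelKolyvaginSystemsAdditive/Ideas/ramified-toric-habitat.md`, sketch `RamifiedHabitatKuriharaSlotSketch.lean` §1) —
# part 1 (LOCAL): the minimal model, the reduction type and Rohrlich's local root number of `E^{(p*)}` at an additive potentially good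
# prime `p ≥ 5` of Kodaira type II, III or IV, and the conductor of `E^{(p*)}`

Cell `pub/bsd-wall`, width seat `bsd-wall-akr-p2x-w2` g11; `--supports stmt-BirchSwinnertonDyer-21396` (helper). THEOREMS ONLY; no definition,
no named fact, no `sorry`. BSD is not proved by any of this; KS′/KPA′ stay OPEN at `p² ∣ N`.

The card's FIRST LEMMA is the sign law `w(E)·w(E^{(d_{K′})}) = +1` (supercuspidal, `e ∤ p − 1`) / `= −1` (principal series) for the
`p`-RAMIFIED habitat `K′` (`p ∣ d_{K′}`, every other bad prime split). Writing `d_{K′} = p*·d′` with `(d′, Np) = 1`, the coprime part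
`d′` is the tree's theorem `rootNumber_quadraticTwist_of_emod_four_eq_one`; what is new is the `p*`-twist `E' = E^{(p*)}`, which at `p`
is again additive potentially good (`e ↦ 12/gcd(12, ord_pΔ + 6)`: `6 ↔ 3`, `4 ↦ 4`). This file supplies the local half:

* §1 `addVal_minimal_pStarTwist_padic` — if the `ℤ_p`-minimal model `X` of `E/ℚ_p` has `ord_p Δ(X) = a` with `a + 6 < 12`, then the
  minimal model of `E'/ℚ_p` has `ord_p Δ = a + 6`, `ord_p c₄ = ord_p c₄(X) + 2` (`X^{(p*)}` is integral with `ord Δ < 12`, hence minimal,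
  Silverman *AEC* VII.1 Rem. 1.1; invariance of `ord Δ`, `ord c₄` among minimal models, Prop. 1.3(b));
  `localRootNumber_mul_pStarTwist_padic` — for `a ∈ {2, 3, 4}` (types II, III, IV; `e = 6, 4, 3`), `ord_p c₄ > 0`, `3·ord_p c₄ ≥ ord_p Δ`:
  BOTH minimal models are ADDITIVE and Rohrlich's case list (Compositio 87 (1993) Prop. 2(iv) = the tree's `localRootNumber`) gives
  `W_p(E)·W_p(E') = (−1/p)·(−3/p)` for `a ∈ {2, 4}` and `(−2/p)² = 1` for `a = 3`.
* §2 `conductorNorm_pStarTwist_eq` — `N_{E'} = N_E` (both additive at `p ≥ 5`, `f_p = 2`; the tree's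
  `AlignedTransportAtTwoAddTwistCoefficients.conductorNorm_quadraticTwist_eq_of_additive`).

Part 2 (`…RamifiedHabitatPStarTwistSign`) assembles `w(E)·w(E') = (M/p)·W_p(E)·W_p(E')` from Atkin–Lehner theory, the Modularity Theorem
and Kellock–Dokchitser's Remark 2.2 at `p`; part 3 (`…RamifiedHabitatSignLaw`) is the habitat sign law itself. Starred types
(`ord_pΔ ∈ {8, 9, 10}`) need the `p`-rescaled twist model and are not treated here.

References: [cite: SilvermanAEC2009, VII.1 Remark 1.1 and Prop. 1.3(b); VII.5 Prop. 5.1] [cite: Rohrlich1993Compositio, Prop. 2(iv)]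
[cite: Silverman1994, IV.10.2 and IV.10.4].
-/

set_option autoImplicit false
set_option linter.dupNamespace false

noncomputable section

open scoped Classical

open IsDedekindDomain IsDedekindDomain.HeightOneSpectrum NumberField Rat.HeightOneSpectrum
  WeierstrassCurve Literature.NumberTheory.EllipticCurves IsDiscreteValuationRing

namespace Summit.BirchSwinnertonDyer.BirchSwinnertonDyer.Theorems.AdditiveKoly.RamifiedHabitat

/-! ## §1 The local computation at `p`: the minimal model of `E^{(p*)}` at `p` and the two local root numbers -/

section Padic

variable {p : ℕ} [Fact p.Prime]

/-- In a DVR `R` with fraction field `K`: if `ord(x) = n` (`addVal`) then the `𝔪`-adic valuation of `x ∈ K` is `exp(−n)`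
(Mathlib's `IsDiscreteValuationRing.intValuation_maximalIdeal`). [folklore] -/
theorem valuation_algebraMap_eq_exp_neg_of_addVal_eq {R : Type*} [CommRing R] [IsDomain R] [IsDiscreteValuationRing R]
    {K : Type*} [Field K] [Algebra R K] [IsFractionRing R K] {x : R} {n : ℕ} (h : addVal R x = n) :
    (IsDiscreteValuationRing.maximalIdeal R).valuation K (algebraMap R K x) = WithZero.exp (-(n : ℤ)) := by
  rw [HeightOneSpectrum.valuation_of_algebraMap, IsDiscreteValuationRing.intValuation_maximalIdeal, h]
  rw [WithZero.exp_neg, WithZero.exp_eq_coe_ofAdd]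
  rfl

/-- **The minimal model of `E^{(p*)}` at `p` from that of `E`, low branch.** Let `X` be the chosen `ℤ_p`-minimal model of
`E/ℚ_p` (`p ≥ 5`) with `ord_p Δ(X) = a`, `a + 6 < 12`. Then `Y = X^{(p*)}` is `p`-integral with `ord_p Δ(Y) = a + 6 < 12`, hence
minimal (Silverman, *AEC* VII.1 Remark 1.1), and `ord_p c₄(Y) = ord_p c₄(X) + 2`; so the chosen minimal model of `E^{(p*)}/ℚ_p` has
`ord_p Δ = a + 6` and `ord_p c₄ = ord_p c₄(X) + 2` (both are invariants of minimal models, *AEC* VII.1 Prop. 1.3(b)).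
[cite: SilvermanAEC2009, VII.1 Remark 1.1 and Prop. 1.3(b)] -/
theorem addVal_minimal_pStarTwist_padic (W : WeierstrassCurve ℚ) [W.IsElliptic] (hp5 : 5 ≤ p) {a : ℕ}
    (hΔ : addVal ℤ_[p] (((W.baseChange ℚ_[p]).minimal ℤ_[p]).integralModel ℤ_[p]).Δ = a) (ha : a + 6 < 12) :
    addVal ℤ_[p] ((((W.quadraticTwist (((-1 : ℤ) ^ (p / 2) * p : ℤ) : ℚ)).baseChange ℚ_[p]).minimal
        ℤ_[p]).integralModel ℤ_[p]).Δ = (a + 6 : ℕ) ∧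
      addVal ℤ_[p] ((((W.quadraticTwist (((-1 : ℤ) ^ (p / 2) * p : ℤ) : ℚ)).baseChange ℚ_[p]).minimal
          ℤ_[p]).integralModel ℤ_[p]).c₄ =
        addVal ℤ_[p] (((W.baseChange ℚ_[p]).minimal ℤ_[p]).integralModel ℤ_[p]).c₄ + 2 := by
  have hvald := addVal_padicInt_pStar (p := p)
  have hVd := valuation_padic_pStar (p := p)
  set d : ℤ := (-1 : ℤ) ^ (p / 2) * p with hd
  set V := (IsDiscreteValuationRing.maximalIdeal ℤ_[p]).valuation ℚ_[p] with hV
  have hp2 : p ≠ 2 := by omega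
  have h2 : IsUnit (2 : ℤ_[p]) := isUnit_two_padicInt hp2
  have hdZ0 : d ≠ 0 :=
    mul_ne_zero (pow_ne_zero _ (by norm_num)) (by exact_mod_cast (Fact.out : p.Prime).ne_zero)
  have hd0 : (d : ℚ) ≠ 0 := by exact_mod_cast hdZ0
  have hdK0 : (d : ℚ_[p]) ≠ 0 := by exact_mod_cast hdZ0
  have hdK : (d : ℚ_[p]) = algebraMap ℤ_[p] ℚ_[p] (d : ℤ_[p]) := by simp
  haveI : (W.quadraticTwist (d : ℚ)).IsElliptic := W.isElliptic_quadraticTwist hd0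
  set Wp := W.baseChange ℚ_[p] with hWp
  set W'p := (W.quadraticTwist (d : ℚ)).baseChange ℚ_[p] with hW'p
  haveI : Wp.IsElliptic := by rw [hWp]; change (W.map _).IsElliptic; infer_instance
  haveI : W'p.IsElliptic := by rw [hW'p]; change ((W.quadraticTwist (d : ℚ)).map _).IsElliptic; infer_instance
  have htwK : W'p = Wp.quadraticTwist (d : ℚ_[p]) := by
    rw [hW'p, hWp, baseChange, baseChange, map_quadraticTwist, map_intCast]
  -- the minimal model `X` of `E_p` and the integral model `Y = X^{(d)}` of `E'_p`
  set X := Wp.minimal ℤ_[p] with hX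
  haveI : X.IsElliptic := by rw [hX]; unfold minimal; infer_instance
  obtain ⟨C, hC⟩ : ∃ C : VariableChange ℚ_[p], X = C • Wp := ⟨_, rfl⟩
  set I := X.integralModel ℤ_[p] with hI
  have hIΔ : I.Δ ≠ 0 := fun h0 ↦ X.isUnit_Δ.ne_zero (by rw [← integralModel_Δ_eq ℤ_[p] X, ← hI, h0, map_zero])
  set Y := X.quadraticTwist (algebraMap ℤ_[p] ℚ_[p] (d : ℤ_[p])) with hY
  haveI hYint : Y.IsIntegral ℤ_[p] := isIntegral_quadraticTwist ℤ_[p] X h2 (d : ℤ_[p])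
  haveI : Y.IsElliptic := X.isElliptic_quadraticTwist (by rw [← hdK]; exact hdK0)
  have hc₄ : (Y.integralModel ℤ_[p]).c₄ = (d : ℤ_[p]) ^ 2 * I.c₄ := by
    apply IsFractionRing.injective ℤ_[p] ℚ_[p]
    rw [integralModel_c₄_eq, map_mul, map_pow, hI, integralModel_c₄_eq, hY, quadraticTwist_c₄]
  have hΔY : (Y.integralModel ℤ_[p]).Δ = (d : ℤ_[p]) ^ 6 * I.Δ := by
    apply IsFractionRing.injective ℤ_[p] ℚ_[p]
    rw [integralModel_Δ_eq, map_mul, map_pow, hI, integralModel_Δ_eq, hY, quadraticTwist_Δ]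
  have hvc₄ : addVal ℤ_[p] (Y.integralModel ℤ_[p]).c₄ = 2 + addVal ℤ_[p] I.c₄ := by
    rw [hc₄, IsDiscreteValuationRing.addVal_mul, IsDiscreteValuationRing.addVal_pow, hvald, nsmul_one,
      Nat.cast_ofNat]
  have hvΔ : addVal ℤ_[p] (Y.integralModel ℤ_[p]).Δ = 6 + addVal ℤ_[p] I.Δ := by
    rw [hΔY, IsDiscreteValuationRing.addVal_mul, IsDiscreteValuationRing.addVal_pow, hvald, nsmul_one,
      Nat.cast_ofNat]
  -- `Y` is minimal: `ord Δ(Y) = a + 6 < 12`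
  have hVX : V X.Δ = WithZero.exp (-(a : ℤ)) := by
    rw [← integralModel_Δ_eq ℤ_[p] X]
    exact valuation_algebraMap_eq_exp_neg_of_addVal_eq hΔ
  rw [hdK] at hVd
  have hYmin : Y.IsMinimal ℤ_[p] := by
    refine isMinimal_of_exp_lt_valuation_Δ Y ?_
    change WithZero.exp (-12 : ℤ) < V Y.Δ
    rw [hY, quadraticTwist_Δ, Valuation.map_mul, Valuation.map_pow, hVd, hVX, ← WithZero.exp_nsmul,
      ← WithZero.exp_add]
    exact WithZero.exp_lt_exp.mpr (by simp only [nsmul_eq_mul]; push_cast; omega)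
  haveI := hYmin
  -- the chosen minimal model of `E'_p` is `K`-isomorphic to `Y`
  obtain ⟨C', hC'⟩ : ∃ C' : VariableChange ℚ_[p], W'p.minimal ℤ_[p] = C' • W'p := ⟨_, rfl⟩
  have hYW : Y = ((⟨C.u, (d : ℚ_[p]) * C.r, 0, 0⟩ : VariableChange ℚ_[p])) • W'p := by
    rw [htwK, hY, ← hdK, hC, quadraticTwist_smul]
  have hE : W'p.minimal ℤ_[p] = (C' * ((⟨C.u, (d : ℚ_[p]) * C.r, 0, 0⟩ : VariableChange ℚ_[p]))⁻¹) • Y := by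
    rw [mul_smul, hYW, inv_smul_smul, ← hC']
  refine ⟨?_, ?_⟩
  · rw [addVal_Δ_integralModel_eq_of_isMinimal_of_eq_smul ℤ_[p] hE, hvΔ, hΔ]
    push_cast; ring
  · rw [addVal_c₄_integralModel_eq_of_isMinimal_of_eq_smul ℤ_[p] hE Y.isUnit_Δ.ne_zero, hvc₄, add_comm]


/-- **Additive reduction read off `ord Δ > 0`, `ord c₄ > 0` of the chosen minimal model** (Silverman, *AEC* VII.5 Prop. 5.1(c);
Mathlib's `HasAdditiveReduction`). [cite: SilvermanAEC2009, VII.5 Prop. 5.1] -/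
theorem hasAdditiveReduction_minimal_padic_of_addVal (V' : WeierstrassCurve ℚ_[p])
    (hΔ : addVal ℤ_[p] ((V'.minimal ℤ_[p]).integralModel ℤ_[p]).Δ ≠ 0)
    (hc₄ : addVal ℤ_[p] ((V'.minimal ℤ_[p]).integralModel ℤ_[p]).c₄ ≠ 0) :
    (V'.minimal ℤ_[p]).HasAdditiveReduction ℤ_[p] := by
  set X := V'.minimal ℤ_[p] with hX
  have h1 : (IsDiscreteValuationRing.maximalIdeal ℤ_[p]).valuation ℚ_[p] X.Δ < 1 := by
    rw [← integralModel_Δ_eq ℤ_[p] X]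
    exact (addVal_ne_zero_iff_valuation_lt_one (K := ℚ_[p]) _).mp hΔ
  have h2 : (IsDiscreteValuationRing.maximalIdeal ℤ_[p]).valuation ℚ_[p] X.c₄ < 1 := by
    rw [← integralModel_c₄_eq ℤ_[p] X]
    exact (addVal_ne_zero_iff_valuation_lt_one (K := ℚ_[p]) _).mp hc₄
  exact ⟨h1, h2⟩

/-- `χ₈'(p)² = 1` for an odd prime `p` (`χ₈'(n) = ±1` for odd `n`, Mathlib `ZMod.χ₈'_nat_eq_if_mod_eight`). [folklore] -/
theorem χ₈'_mul_self_of_odd {n : ℕ} (hn : n % 2 = 1) : ZMod.χ₈' n * ZMod.χ₈' n = 1 := by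
  rw [ZMod.χ₈'_nat_eq_if_mod_eight]
  have : n % 8 = 1 ∨ n % 8 = 3 ∨ n % 8 = 5 ∨ n % 8 = 7 := by omega
  have hn2 : ¬ n % 2 = 0 := by omega
  rcases this with h | h | h | h <;> simp [h, hn2]

/-- **The two local root numbers at `p` (low branch).** Let `X` be the chosen `ℤ_p`-minimal model of `E/ℚ_p`, `p ≥ 5`, with
ADDITIVE POTENTIALLY GOOD reduction: `ord_p Δ(X) = a ∈ {2, 3, 4}` (Kodaira types II, III, IV; `e = 12/gcd(12, a) = 6, 4, 3`),
`ord_p c₄(X) > 0`, `3·ord_p c₄(X) ≥ ord_p Δ(X)`. Then `E' = E^{(p*)}` is again additive potentially good at `p` with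
`ord_p Δ = a + 6` (`e' = 3, 4, 6`), and Rohrlich's case list (Compositio 87 (1993), Prop. 2(iv); the tree's `localRootNumber`)
gives `W_p(E)·W_p(E') = (−1/p)·(−3/p) = (3/p)` for `a ∈ {2, 4}` and `= (−2/p)² = 1` for `a = 3`.
[cite: Rohrlich1993Compositio, Prop. 2(iv)] [cite: SilvermanAEC2009, VII.1 Remark 1.1] -/
theorem localRootNumber_mul_pStarTwist_padic (W : WeierstrassCurve ℚ) [W.IsElliptic] (hp5 : 5 ≤ p) {a : ℕ}
    (hΔ : addVal ℤ_[p] (((W.baseChange ℚ_[p]).minimal ℤ_[p]).integralModel ℤ_[p]).Δ = a)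
    (ha : a = 2 ∨ a = 3 ∨ a = 4)
    (hc₄ : addVal ℤ_[p] (((W.baseChange ℚ_[p]).minimal ℤ_[p]).integralModel ℤ_[p]).c₄ ≠ 0)
    (hj : ¬ 3 * addVal ℤ_[p] (((W.baseChange ℚ_[p]).minimal ℤ_[p]).integralModel ℤ_[p]).c₄ <
      addVal ℤ_[p] (((W.baseChange ℚ_[p]).minimal ℤ_[p]).integralModel ℤ_[p]).Δ) :
    ((W.baseChange ℚ_[p]).minimal ℤ_[p]).HasAdditiveReduction ℤ_[p] ∧
      (((W.quadraticTwist (((-1 : ℤ) ^ (p / 2) * p : ℤ) : ℚ)).baseChange ℚ_[p]).minimal ℤ_[p]).HasAdditiveReduction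
        ℤ_[p] ∧
      (W.baseChange ℚ_[p]).localRootNumber ℤ_[p] *
          ((W.quadraticTwist (((-1 : ℤ) ^ (p / 2) * p : ℤ) : ℚ)).baseChange ℚ_[p]).localRootNumber ℤ_[p] =
        if a = 3 then 1 else ZMod.χ₄ p * (if p % 3 = 1 then 1 else -1) := by
  have hp2 : p ≠ 2 := by omega
  have hpodd : p % 2 = 1 := (Nat.Prime.eq_two_or_odd (Fact.out : p.Prime)).resolve_left hp2
  obtain ⟨hΔ', hc₄'⟩ := addVal_minimal_pStarTwist_padic W hp5 hΔ (by omega)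
  set I := ((W.baseChange ℚ_[p]).minimal ℤ_[p]).integralModel ℤ_[p] with hI
  set I' := (((W.quadraticTwist (((-1 : ℤ) ^ (p / 2) * p : ℤ) : ℚ)).baseChange ℚ_[p]).minimal
    ℤ_[p]).integralModel ℤ_[p] with hI'
  have ha0 : addVal ℤ_[p] I.Δ ≠ 0 := by rw [hΔ]; exact_mod_cast (show a ≠ 0 by omega)
  have ha0' : addVal ℤ_[p] I'.Δ ≠ 0 := by rw [hΔ']; exact_mod_cast (show a + 6 ≠ 0 by omega)
  have hc0' : addVal ℤ_[p] I'.c₄ ≠ 0 := by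
    rw [hc₄']
    exact fun h ↦ absurd (add_eq_zero.mp h).2 (by norm_num)
  have hadd := hasAdditiveReduction_minimal_padic_of_addVal (W.baseChange ℚ_[p]) ha0 hc₄
  have hadd' := hasAdditiveReduction_minimal_padic_of_addVal
    ((W.quadraticTwist (((-1 : ℤ) ^ (p / 2) * p : ℤ) : ℚ)).baseChange ℚ_[p]) ha0' hc0'
  refine ⟨hadd, hadd', ?_⟩
  -- potentially good for the twist as well
  have hj' : ¬ 3 * addVal ℤ_[p] I'.c₄ < addVal ℤ_[p] I'.Δ := by
    rw [hc₄', hΔ']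
    intro hlt
    apply hj
    rw [hΔ]
    -- `3 (c + 2) < a + 6 → 3 c < a`
    by_cases htop : addVal ℤ_[p] I.c₄ = ⊤
    · simp [htop] at hlt
    · obtain ⟨c, hc⟩ := ENat.ne_top_iff_exists.mp htop
      rw [← hc] at hlt ⊢
      have h1 : ((3 * (c + 2) : ℕ) : ℕ∞) < ((a + 6 : ℕ) : ℕ∞) := by push_cast; exact hlt
      have h2 : 3 * (c + 2) < a + 6 := by exact_mod_cast h1
      exact_mod_cast (show 3 * c < a by omega)
  rw [localRootNumber_padic_of_hasAdditiveReduction p _ hp5 hadd,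
    localRootNumber_padic_of_hasAdditiveReduction p _ hp5 hadd', if_neg hj, if_neg hj']
  rw [← hI, ← hI', hΔ, hΔ']
  simp only [ENat.toNat_coe]
  rcases ha with rfl | rfl | rfl
  · -- `a = 2`: `e = 6`, `e' = 3`
    have e1 : 12 / Nat.gcd 2 12 = 6 := by decide
    have e2 : 12 / Nat.gcd (2 + 6) 12 = 3 := by decide
    simp only [e1, e2]
    norm_num
  · -- `a = 3`: `e = e' = 4`
    have e1 : 12 / Nat.gcd 3 12 = 4 := by decide
    have e2 : 12 / Nat.gcd (3 + 6) 12 = 4 := by decide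
    simp only [e1, e2]
    norm_num
    exact χ₈'_mul_self_of_odd hpodd
  · -- `a = 4`: `e = 3`, `e' = 6`
    have e1 : 12 / Nat.gcd 4 12 = 3 := by decide
    have e2 : 12 / Nat.gcd (4 + 6) 12 = 6 := by decide
    simp only [e1, e2]
    norm_num

end Padic


/-! ## §2 The conductor of `E^{(p*)}`: both curves are additive at `p ≥ 5`, so `N_{E^{(p*)}} = N_E` -/

section Conductor

variable {p : ℕ} [Fact p.Prime]

/-- `p* ≡ 1 (mod 4)`. [folklore] -/
theorem pStar_emod_four (hp2 : p ≠ 2) : ((-1 : ℤ) ^ (p / 2) * p) % 4 = 1 := by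
  have h := four_dvd_pStar_sub_one (p := p) hp2
  omega

/-- A prime dividing `p*` is `p`. [folklore] -/
theorem eq_of_prime_dvd_pStar {q : ℕ} (hq : q.Prime) (h : (q : ℤ) ∣ (-1 : ℤ) ^ (p / 2) * p) : q = p := by
  have hu : IsUnit ((-1 : ℤ) ^ (p / 2)) := (isUnit_neg_one (α := ℤ)).pow _
  have h' : (q : ℤ) ∣ (p : ℤ) := (hu.dvd_mul_left).mp h
  exact (Nat.prime_dvd_prime_iff_eq hq Fact.out).mp (Int.natCast_dvd_natCast.mp h')

/-- **`N_{E^{(p*)}} = N_E`** when `E` and `E^{(p*)}` are both additive at `p ≥ 5` (`f_p = 2` on both sides; away from `p` the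
twist is by a unit and the exponents agree): the tree's `conductorNorm_quadraticTwist_eq_of_additive` (route
`AlignedTransportAtTwo`, Silverman ATAEC IV.10.2, IV.10.4) fed with the `ℤ_p`-side additivity through the bridge
`hasAdditiveReduction_padic_iff_hasAdditiveReductionAt_ringOfIntegers`. [cite: Silverman1994, IV.10.2(c) and IV.10.4] -/
theorem conductorNorm_pStarTwist_eq (W : WeierstrassCurve ℚ) [W.IsElliptic] (hp5 : 5 ≤ p)
    [(W.quadraticTwist (((-1 : ℤ) ^ (p / 2) * p : ℤ) : ℚ)).IsElliptic]
    (hadd : ((W.baseChange ℚ_[p]).minimal ℤ_[p]).HasAdditiveReduction ℤ_[p])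
    (hadd' : (((W.quadraticTwist (((-1 : ℤ) ^ (p / 2) * p : ℤ) : ℚ)).baseChange ℚ_[p]).minimal
      ℤ_[p]).HasAdditiveReduction ℤ_[p]) :
    (W.quadraticTwist (((-1 : ℤ) ^ (p / 2) * p : ℤ) : ℚ)).conductorNorm ℤ = W.conductorNorm ℤ := by
  have hp : p.Prime := Fact.out
  have hp2 : p ≠ 2 := by omega
  -- the `ℤ_p`-statements, moved to the place of `𝓞 ℚ` over `p`
  have h1 : W.HasAdditiveReductionAt ((primesEquiv (R := 𝓞 ℚ)).symm ⟨p, hp⟩) :=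
    (W.hasAdditiveReductionAt_int_iff_ringOfIntegers ⟨p, hp⟩).mp
      ((W.hasAdditiveReduction_padic_iff_hasAdditiveReductionAt_int ⟨p, hp⟩).mp hadd)
  have h2 : (W.quadraticTwist (((-1 : ℤ) ^ (p / 2) * p : ℤ) : ℚ)).HasAdditiveReductionAt
      ((primesEquiv (R := 𝓞 ℚ)).symm ⟨p, hp⟩) :=
    ((W.quadraticTwist _).hasAdditiveReductionAt_int_iff_ringOfIntegers ⟨p, hp⟩).mp
      (((W.quadraticTwist _).hasAdditiveReduction_padic_iff_hasAdditiveReductionAt_int ⟨p, hp⟩).mp hadd')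
  -- a place of `𝓞 ℚ` over a prime dividing `p*` is that place
  have key : ∀ v : HeightOneSpectrum (𝓞 ℚ), ((primesEquiv v : ℕ) : ℤ) ∣ (-1 : ℤ) ^ (p / 2) * p →
      v = (primesEquiv (R := 𝓞 ℚ)).symm ⟨p, hp⟩ := by
    intro v hv
    have hq : primesEquiv v = ⟨p, hp⟩ := Subtype.ext (eq_of_prime_dvd_pStar (primesEquiv v).2 hv)
    rw [← hq, Equiv.symm_apply_apply]
  refine AlignedTransportAtTwoAddTwistCoefficients.conductorNorm_quadraticTwist_eq_of_additive W (pStar_emod_four hp2)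
    (fun v hv ↦ by rw [eq_of_prime_dvd_pStar (primesEquiv v).2 hv]; exact hp5)
    (fun v hv ↦ ?_) (fun v hv ↦ ?_)
  · rw [key v hv]; exact h1
  · rw [key v hv]; exact h2

end Conductor

end Summit.BirchSwinnertonDyer.BirchSwinnertonDyer.Theorems.AdditiveKoly.RamifiedHabitat

end
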